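import Literature.AlgebraicGeometry.Frobenioids.ModelFrobenioidEndMonoid
import Literature.AlgebraicGeometry.Frobenioids.ModelFrobenioidCofinal
import HarnessLib

/-!
# Frobenioids II, Theorem 2.4 (ii) junction — base lemmas for the rational-function transport `Ψ_B`:
# `B(X)` of a `p`-adic Frobenioid is generated by its effective part `O^▷((X,0))`, and the `O^▷`-squares
# along base-identity linear morphisms and along the linear lifts `(1, g, 0, 1)`

Mochizuki, *The geometry of Frobenioids I: the general theory*, Kyushu J. Math. **62** (2008) 293–400, §0 p. 10
(monoprime monoids `≅ ℤ_{≥0}, ℚ_{≥0}, ℝ_{≥0}`), Prop. 1.11 (iv) p. 37 (a linear `φ : A → B` induces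
`O^▷(B) ↪ O^▷(A)`), Thm. 5.2 (i)/(ii) pp. 100–101 (the model Frobenioid; `O^▷(A) = {b ∈ B(A_D) | Div_B(b) ≥ 0}`)
[cite: MochizukiFrdI2008, Thm. 5.2(i) p.100]; *The geometry of Frobenioids II*, Kyushu J. Math. **62** (2008)
401–460, Ex. 1.1 (ii) p. 8 (`B = B₀ ×_{Φ₀^gp} Φ^gp`, `Φ` monoprime) and proof of Thm. 2.4 (i) p. 20
("`Ψ` induces … compatible isomorphisms of functors … `B₁ ⥲ B₂`") [cite: MochizukiFrdII2008, Thm 2.4 (i) p.20].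

PROOF-ONLY file (cell abc-iut, layer L1, row «T24ii-J2» piece P6, seat abc-iut-L1-d3 gen 7; part 1 of 2, consumed by
`PadicFrobenioidPsiBOfEquivalence.lean`).  Contents, all over LANDED vocabulary (abc-iut-w5-d248's O-monoid dictionary
`ModelFrobenioidEndMonoid`, abc-iut-L1-t2's `zeroObj`/`zeroHom`/`unitEnd`, `ModelFrobenioidCofinal`):
* §1 `Φ` monoprime ⇒ every element of `Φ^gp` is `+c` or `−c` (`IsMonoprime.exists_eq_of_or_eq_of_inv`);
* §2 for a `p`-adic datum: every `b ∈ B(X)` is effective or inverse-effective (`effective_or_inv_effective`); transport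
  formulas in `B` along base arrows; and the two `O^▷`-SQUARES carried through any functor `F : C → C′` preserving
  `O^▷` and linearity, with a base compatibility `η : F ⋙ Base′ ≅ Base ⋙ E`: `unit_map_eq_of_unit_eq_zeroObj`
  (the clause at an ARBITRARY `A = (X, α)` reduced to `(X, 0)` through `A″ = (X, a)`, `α = a − b`, along
  `(1, id, b, 1)` and `(1, id, a, 1)` — `A` need not be isomorphic to `(X, 0)`) and `unit_map_eq_of_unit_eq_pull`
  (along `(1, g, 0, 1)`, Prop. 1.11 (iv)).
No definitions; nothing of either paper is restated or strengthened; nothing here bears on [IUTchIII] Cor. 3.12.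
-/

noncomputable section

namespace Literature.AlgebraicGeometry.Frobenioids

open CategoryTheory Opposite Function

/-! ### §1 Monoprime divisor monoids: every element of `Φ^gp` is effective or anti-effective -/

section Monoprime

variable {M : Type*} [CommMonoid M]

/-- In the groupification of a MONOPRIME monoid (`≅ ℤ_{≥0}, ℚ_{≥0}, ℝ_{≥0}`, [FrdI] §0 p. 10) every element is `+c`
or `−c` for an element `c` of the monoid. [cite: MochizukiFrdI2008, §0 p.10] -/
theorem IsMonoprime.exists_eq_of_or_eq_of_inv (hM : IsMonoprime M) (γ : Algebra.GrothendieckGroup M) :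
    ∃ c : M, γ = Algebra.GrothendieckGroup.of c ∨ γ = (Algebra.GrothendieckGroup.of c)⁻¹ := by
  obtain ⟨a, b, hab⟩ := grothendieckGroup_exists_mul_of_eq_of γ
  rcases hM.dvd_or_dvd b a with ⟨e, he⟩ | ⟨e, he⟩
  · refine ⟨e, Or.inl ?_⟩
    rw [he, map_mul, mul_comm (Algebra.GrothendieckGroup.of b)] at hab
    exact mul_right_cancel hab
  · refine ⟨e, Or.inr (eq_inv_of_mul_eq_one_left ?_)⟩
    rw [he, map_mul, ← mul_assoc, mul_right_comm] at hab
    exact mul_right_cancel (hab.trans (one_mul _).symm)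

end Monoprime

namespace PadicFrd.Datum

/-! ### §2 One datum: `B(X)` is generated by the effective rational functions `B^▷(X) = {b | Div_B b ≥ 0}` -/

section OneDatum

universe v u

variable {D : Type u} [Category.{v} D] {p : ℕ} [Fact p.Prime] (d : Datum D p)

/-- **Every rational function is effective or inverse-effective**: for `b ∈ B(X)` of the `p`-adic Frobenioid either
`Div_B(b) ≥ 0` or `Div_B(b⁻¹) ≥ 0` (`Φ(X)` is monoprime, `B(X)` is a group). [cite: MochizukiFrdII2008, Ex 1.1 (ii) p.8] -/
theorem effective_or_inv_effective (X : Dᵒᵖ) (b : d.B.obj X) :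
    (∃ c : d.Φ.obj X, Algebra.GrothendieckGroup.of c = Frobenioids.divB d.Φ d.B d.divB X b) ∨
      ∃ b' : d.B.obj X, (∃ c : d.Φ.obj X, Algebra.GrothendieckGroup.of c = Frobenioids.divB d.Φ d.B d.divB X b') ∧
        b * b' = 1 := by
  obtain ⟨c, hc | hc⟩ := (d.isMonoprime X).exists_eq_of_or_eq_of_inv (Frobenioids.divB d.Φ d.B d.divB X b)
  · exact Or.inl ⟨c, hc.symm⟩
  · obtain ⟨u, hu⟩ := d.isUnit_B X b
    refine Or.inr ⟨↑u⁻¹, ⟨c, ?_⟩, by rw [← hu, Units.mul_inv]⟩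
    have h1 : Frobenioids.divB d.Φ d.B d.divB X b * Frobenioids.divB d.Φ d.B d.divB X ↑u⁻¹ = 1 := by
      rw [← map_mul, ← hu, Units.mul_inv, map_one]
    rw [hc] at h1
    exact inv_mul_eq_one.mp h1

/-- Totality of the effective submonoid `B^▷(X) = Div_B⁻¹(Φ(X)) ⊆ B(X)` in the form consumed by the extension-by-totality step of part 2.
[cite: MochizukiFrdII2008, Ex 1.1 (ii) p.8] -/
theorem effective_total (X : Dᵒᵖ) (b : d.B.obj X) :
    b ∈ (MonoidHom.mrange (Algebra.GrothendieckGroup.of (M := d.Φ.obj X))).comap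
        (Frobenioids.divB d.Φ d.B d.divB X) ∨
      ∃ m ∈ (MonoidHom.mrange (Algebra.GrothendieckGroup.of (M := d.Φ.obj X))).comap
        (Frobenioids.divB d.Φ d.B d.divB X), b * m = 1 := by
  rcases d.effective_or_inv_effective X b with ⟨c, hc⟩ | ⟨b', ⟨c, hc⟩, hbb'⟩
  · exact Or.inl (Submonoid.mem_comap.mpr ⟨c, hc⟩)
  · exact Or.inr ⟨b', Submonoid.mem_comap.mpr ⟨c, hc⟩, hbb'⟩

/-- Membership in `B^▷(X)` is effectivity of the divisor. [cite: MochizukiFrdII2008, Ex 1.1 (ii) p.8] -/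
theorem mem_effective_iff (X : Dᵒᵖ) (b : d.B.obj X) :
    b ∈ (MonoidHom.mrange (Algebra.GrothendieckGroup.of (M := d.Φ.obj X))).comap
        (Frobenioids.divB d.Φ d.B d.divB X) ↔
      ∃ c : d.Φ.obj X, Algebra.GrothendieckGroup.of c = Frobenioids.divB d.Φ d.B d.divB X b :=
  Submonoid.mem_comap.trans MonoidHom.mem_mrange

/-- Transport in `B` along a composite of base arrows, on elements. [cite: MochizukiFrdI2008, Thm. 5.2(i) p.100] -/
theorem B_map_comp_apply {X Y Z : D} (f : X ⟶ Y) (g : Y ⟶ Z) (x : d.B.obj (op Z)) :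
    (d.B.map (f ≫ g).op).hom x = (d.B.map f.op).hom ((d.B.map g.op).hom x) := by
  rw [op_comp, d.B.map_comp, CommMonCat.comp_apply]

/-- Transport in `B` along an isomorphism of the base and back is the identity, on elements.
[cite: MochizukiFrdI2008, Thm. 5.2(i) p.100] -/
theorem B_map_hom_inv_apply {Y Z : D} (θ : Y ≅ Z) (x : d.B.obj (op Y)) :
    (d.B.map θ.hom.op).hom ((d.B.map θ.inv.op).hom x) = x := by
  rw [← B_map_comp_apply, θ.hom_inv_id, op_id, d.B.map_id, CommMonCat.id_apply]

/-- Transport in `B`: `(a ≫ θ⁻¹)^* ∘ (θ ≫ c)^* = (a ≫ c)^*` on elements. [cite: MochizukiFrdI2008, Thm. 5.2(i) p.100] -/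
theorem B_map_comp_iso_apply {X Y Y' Z : D} (a : X ⟶ Y) (θ : Y' ≅ Y) (c : Y ⟶ Z) (u : d.B.obj (op Z)) :
    (d.B.map (a ≫ θ.inv).op).hom ((d.B.map (θ.hom ≫ c).op).hom u) = (d.B.map (a ≫ c).op).hom u := by
  rw [← B_map_comp_apply, Category.assoc, θ.inv_hom_id_assoc]

/-- Transport in `B`: `(θ⁻¹)^* ∘ (θ ≫ m ≫ n)^* = m^* ∘ n^*` on elements. [cite: MochizukiFrdI2008, Thm. 5.2(i) p.100] -/
theorem B_map_iso_conj_apply {Y₁ Y₂ Z₂ Z₁ : D} (θ : Y₁ ≅ Y₂) (m : Y₂ ⟶ Z₂) (n : Z₂ ⟶ Z₁) (u : d.B.obj (op Z₁)) :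
    (d.B.map θ.inv.op).hom ((d.B.map (θ.hom ≫ m ≫ n).op).hom u) = (d.B.map m.op).hom ((d.B.map n.op).hom u) := by
  rw [← B_map_comp_apply, ← B_map_comp_apply, θ.inv_hom_id_assoc]

/-- **The `O^▷`-clause at an ARBITRARY object, reduced to the zero object over the same base.**  For a functor
`F : C → C′` between the model Frobenioids of two `p`-adic data carrying base-identity linear endomorphisms to
base-identity linear endomorphisms and base-identity linear MORPHISMS `(1, id, c, 1)` to morphisms of Frobenius
degree `1`, with a base compatibility `η : F ⋙ Base′ ≅ Base ⋙ E`: if `f ∈ O^▷(A)`, `A = (X, α)`, and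
`f₀ ∈ O^▷((X, 0))` have the same rational function, then `u_{F f} = (η_A ≫ η_{(X,0)}⁻¹)^* u_{F f₀}` — through
`A″ = (X, a)`, `α = a − b`, and Prop. 1.11 (iv) along `(1, id, b, 1) : A → A″`, `(1, id, a, 1) : (X,0) → A″`.
[cite: MochizukiFrdI2008, Prop. 1.11 (iv) p.37] -/
theorem unit_map_eq_of_unit_eq_zeroObj {D' : Type u} [Category.{v} D'] {p' : ℕ} [Fact p'.Prime] (d' : Datum D' p')
    (F : d.frobenioid ⥤ d'.frobenioid) (E : D ⥤ D')
    (η : F ⋙ ModelFrobenioid.baseFunctor d'.Φ d'.B d'.divB ≅ ModelFrobenioid.baseFunctor d.Φ d.B d.divB ⋙ E)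
    (hO : ∀ (A : d.frobenioid) (f : A ⟶ A), f ∈ PreFrobenioid.endSubmonoid d.structureFunctor A →
      F.map f ∈ PreFrobenioid.endSubmonoid d'.structureFunctor (F.obj A))
    (hdeg : ∀ (A A' : d.frobenioid) (φ : A ⟶ A'), ModelFrobenioid.degFr φ = 1 →
      ModelFrobenioid.degFr (F.map φ) = 1)
    (A : d.frobenioid) {f : A ⟶ A} (hf : f ∈ PreFrobenioid.endSubmonoid d.structureFunctor A)
    {f₀ : ModelFrobenioid.zeroObj d.Φ d.B d.divB A.base ⟶ ModelFrobenioid.zeroObj d.Φ d.B d.divB A.base}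
    (hf₀ : f₀ ∈ PreFrobenioid.endSubmonoid d.structureFunctor _)
    (hu : ModelFrobenioid.unit f₀ = ModelFrobenioid.unit f) :
    ModelFrobenioid.unit (F.map f) =
      (d'.B.map (η.hom.app A ≫ η.inv.app (ModelFrobenioid.zeroObj d.Φ d.B d.divB A.base)).op).hom
        (ModelFrobenioid.unit (F.map f₀)) := by
  -- write `α = a − b`
  obtain ⟨a, b, hab⟩ := grothendieckGroup_exists_mul_of_eq_of A.cls
  -- the auxiliary object `A″ = (X, a)` and the two base-identity linear morphisms into it
  let A'' : d.frobenioid := ⟨A.base, Algebra.GrothendieckGroup.of a⟩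
  have hrel₁ : A.cls ^ ((1 : ℕ+) : ℕ) * Algebra.GrothendieckGroup.of b =
      pullGp d.Φ (𝟙 A.base) (Algebra.GrothendieckGroup.of a) * Frobenioids.divB d.Φ d.B d.divB (op A.base) 1 := by
    rw [PNat.one_coe, pow_one, pullGp_id, map_one, mul_one, hab]
  let ψ₁ : A ⟶ A'' := { degFr := 1, base := 𝟙 A.base, div := b, unit := 1, rel := hrel₁ }
  let A₀ : d.frobenioid := ModelFrobenioid.zeroObj d.Φ d.B d.divB A.base
  have hrel₂ : (1 : Algebra.GrothendieckGroup (d.Φ.obj (op A.base))) ^ ((1 : ℕ+) : ℕ) *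
        Algebra.GrothendieckGroup.of a =
      pullGp d.Φ (𝟙 A.base) (Algebra.GrothendieckGroup.of a) * Frobenioids.divB d.Φ d.B d.divB (op A.base) 1 := by
    rw [one_pow, one_mul, pullGp_id, map_one, mul_one]
  let ψ₂ : A₀ ⟶ A'' := { degFr := 1, base := 𝟙 A.base, div := a, unit := 1, rel := hrel₂ }
  -- `f″ := (1, id, Div f, u_f) ∈ O^▷(A″)`
  have hdf : Algebra.GrothendieckGroup.of (ModelFrobenioid.div f) =
      Frobenioids.divB d.Φ d.B d.divB (op A.base) (ModelFrobenioid.unit f) :=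
    ModelFrobenioid.of_div_eq_divB_unit_of_mem_endSubmonoid hf
  let f'' : A'' ⟶ A'' := ModelFrobenioid.unitEnd A'' (ModelFrobenioid.div f :) (ModelFrobenioid.unit f :) hdf
  have hf'' : f'' ∈ PreFrobenioid.endSubmonoid d.structureFunctor A'' := ⟨rfl, rfl⟩
  -- the two intertwining squares (Prop. 1.11 (iv)), pinned by the rational function
  have hsq₁ : f ≫ ψ₁ = ψ₁ ≫ f'' := by
    obtain ⟨f₁, hf₁, hcomm, hunit, -⟩ := ModelFrobenioid.exists_intertwiner_of_linear ψ₁ rfl hf''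
    have : f₁ = f := ModelFrobenioid.eq_of_mem_endSubmonoid_of_unit_eq (d.isIntegral_Φ _) hf₁ hf
      (by rw [hunit]; exact ModelFrobenioid.map_id_apply_B _ _)
    rw [← this, hcomm]
  have hsq₂ : f₀ ≫ ψ₂ = ψ₂ ≫ f'' := by
    obtain ⟨f₁, hf₁, hcomm, hunit, -⟩ := ModelFrobenioid.exists_intertwiner_of_linear ψ₂ rfl hf''
    have : f₁ = f₀ := ModelFrobenioid.eq_of_mem_endSubmonoid_of_unit_eq (d.isIntegral_Φ _) hf₁ hf₀
      (by rw [hunit, hu]; exact ModelFrobenioid.map_id_apply_B _ _)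
    rw [← this, hcomm]
  -- apply `F` and read off the rational functions in `C′`
  have hF₁ : F.map f ≫ F.map ψ₁ = F.map ψ₁ ≫ F.map f'' := by rw [← F.map_comp, hsq₁, F.map_comp]
  have hF₂ : F.map f₀ ≫ F.map ψ₂ = F.map ψ₂ ≫ F.map f'' := by rw [← F.map_comp, hsq₂, F.map_comp]
  have hu₁ := d'.unit_eq_of_intertwine (F.map ψ₁) (hdeg _ _ ψ₁ rfl) (hO _ _ hf) (hO _ _ hf'') hF₁
  have hu₂ := d'.unit_eq_of_intertwine (F.map ψ₂) (hdeg _ _ ψ₂ rfl) (hO _ _ hf₀) (hO _ _ hf'') hF₂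
  -- the bases of `F ψ₁`, `F ψ₂` through `η` (both lie over `id_X`, where `E(id_X) = id`)
  have hE : ∀ {α₁ α₂ : Algebra.GrothendieckGroup (d.Φ.obj (op A.base))}
      (ψ : (⟨A.base, α₁⟩ : d.frobenioid) ⟶ ⟨A.base, α₂⟩), ModelFrobenioid.baseMap ψ = 𝟙 A.base →
      ModelFrobenioid.baseMap (F.map ψ) = η.hom.app ⟨A.base, α₁⟩ ≫ η.inv.app ⟨A.base, α₂⟩ := by
    intro α₁ α₂ ψ hψ
    refine (Iso.eq_comp_inv (η.app ⟨A.base, α₂⟩)).mpr ?_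
    have h := η.hom.naturality ψ
    have h1 : (ModelFrobenioid.baseFunctor d.Φ d.B d.divB ⋙ E).map ψ =
        𝟙 ((ModelFrobenioid.baseFunctor d.Φ d.B d.divB ⋙ E).obj ⟨A.base, α₁⟩) := by
      show E.map (ModelFrobenioid.baseMap ψ) = _
      rw [hψ]
      exact E.map_id _
    have h2 : η.hom.app ⟨A.base, α₁⟩ ≫ (ModelFrobenioid.baseFunctor d.Φ d.B d.divB ⋙ E).map ψ =
        η.hom.app ⟨A.base, α₁⟩ := by
      rw [h1]
      exact Category.comp_id _
    exact h.trans h2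
  have hb₁ : ModelFrobenioid.baseMap (F.map ψ₁) = η.hom.app A ≫ η.inv.app A'' := hE ψ₁ rfl
  have hb₂ : ModelFrobenioid.baseMap (F.map ψ₂) = η.hom.app A₀ ≫ η.inv.app A'' := hE ψ₂ rfl
  rw [hb₁] at hu₁
  rw [hb₂] at hu₂
  -- solve for `u_{F f″}` from the second square and substitute into the first
  have hu₂' : ModelFrobenioid.unit (F.map f'') =
      (d'.B.map (η.hom.app A'' ≫ η.inv.app A₀).op).hom (ModelFrobenioid.unit (F.map f₀)) := by
    rw [hu₂]
    exact (d'.B_map_hom_inv_apply ((η.app A'') ≪≫ (η.app A₀).symm) _).symm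
  rw [hu₁, hu₂']
  exact d'.B_map_comp_iso_apply (η.hom.app A) (η.app A'') (η.inv.app A₀) _

/-- **Naturality input**: along `g : X′ → X` of the base, the intertwiner `f′ ∈ O^▷((X′,0))` of `f ∈ O^▷((X,0))`
across the linear lift `(1, g, 0, 1)` (Prop. 1.11 (iv): `u_{f′} = B(g)(u_f)`) is carried by `F` to the intertwiner
across `F(1, g, 0, 1)`, whose base is `η_{(X′,0)} ≫ E(g) ≫ η_{(X,0)}⁻¹`. [cite: MochizukiFrdI2008, Prop. 1.11 (iv) p.37] -/
theorem unit_map_eq_of_unit_eq_pull {D' : Type u} [Category.{v} D'] {p' : ℕ} [Fact p'.Prime] (d' : Datum D' p')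
    (F : d.frobenioid ⥤ d'.frobenioid) (E : D ⥤ D')
    (η : F ⋙ ModelFrobenioid.baseFunctor d'.Φ d'.B d'.divB ≅ ModelFrobenioid.baseFunctor d.Φ d.B d.divB ⋙ E)
    (hO : ∀ (A : d.frobenioid) (f : A ⟶ A), f ∈ PreFrobenioid.endSubmonoid d.structureFunctor A →
      F.map f ∈ PreFrobenioid.endSubmonoid d'.structureFunctor (F.obj A))
    (hdeg : ∀ (A A' : d.frobenioid) (φ : A ⟶ A'), ModelFrobenioid.degFr φ = 1 →
      ModelFrobenioid.degFr (F.map φ) = 1)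
    {X X' : D} (g : X' ⟶ X)
    {f : ModelFrobenioid.zeroObj d.Φ d.B d.divB X ⟶ ModelFrobenioid.zeroObj d.Φ d.B d.divB X}
    (hf : f ∈ PreFrobenioid.endSubmonoid d.structureFunctor _)
    {f' : ModelFrobenioid.zeroObj d.Φ d.B d.divB X' ⟶ ModelFrobenioid.zeroObj d.Φ d.B d.divB X'}
    (hf' : f' ∈ PreFrobenioid.endSubmonoid d.structureFunctor _)
    (hu : ModelFrobenioid.unit f' = (d.B.map g.op).hom (ModelFrobenioid.unit f)) :
    ModelFrobenioid.unit (F.map f') =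
      (d'.B.map (η.hom.app (ModelFrobenioid.zeroObj d.Φ d.B d.divB X') ≫ E.map g ≫
          η.inv.app (ModelFrobenioid.zeroObj d.Φ d.B d.divB X)).op).hom
        (ModelFrobenioid.unit (F.map f)) := by
  let φ : ModelFrobenioid.zeroObj d.Φ d.B d.divB X' ⟶ ModelFrobenioid.zeroObj d.Φ d.B d.divB X :=
    ModelFrobenioid.zeroHom 1 g
  have hsq : f' ≫ φ = φ ≫ f := by
    obtain ⟨f₁, hf₁, hcomm, hunit, -⟩ := ModelFrobenioid.exists_intertwiner_of_linear φ rfl hf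
    have : f₁ = f' :=
      ModelFrobenioid.eq_of_mem_endSubmonoid_of_unit_eq (d.isIntegral_Φ _) hf₁ hf' (by rw [hunit, hu]; rfl)
    rw [← this, hcomm]
  have hF : F.map f' ≫ F.map φ = F.map φ ≫ F.map f := by rw [← F.map_comp, hsq, F.map_comp]
  have hu₁ := d'.unit_eq_of_intertwine (F.map φ) (hdeg _ _ φ rfl) (hO _ _ hf') (hO _ _ hf) hF
  have hb : ModelFrobenioid.baseMap (F.map φ) =
      η.hom.app (ModelFrobenioid.zeroObj d.Φ d.B d.divB X') ≫ E.map g ≫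
        η.inv.app (ModelFrobenioid.zeroObj d.Φ d.B d.divB X) := by
    rw [← Category.assoc]
    refine (Iso.eq_comp_inv (η.app (ModelFrobenioid.zeroObj d.Φ d.B d.divB X))).mpr ?_
    exact η.hom.naturality φ
  rw [hu₁, hb]
  rfl

end OneDatum

end PadicFrd.Datum

end Literature.AlgebraicGeometry.Frobenioids

end
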